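import Summits.Ventures.MM22.Rank333.ProfileCertKernel
import Literature.NumberTheory.Sieve.GoldbachLinnikAConstCert
import Mathlib.Data.Finset.Card
import Mathlib.Data.Fintype.Basic
import Mathlib.Algebra.BigOperators.Group.Finset.Basic
import HarnessLib

/-!
# MM22 venture — PROFILE-CERT kernel replay: forms, masks, counting, states (lemmas)

HONEST FRAMING (cell `pub-mm22`, seat p1 g5; V4-MENU item (0′) «kernel replay of the whole-root PROFILE-CERT»).
Checker PLUMBING with soundness theorems, written from the FROZEN format specification
`HOME/pub-mm22-p2/pcert/PROFILE-CERT-v1-frozen-20260822T2120Z.md` (sha256 59fc6c87…) only. The end declaration of the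
chain (`ProfileCertGlue.rankGe21F2_of_pieces`) is an IMPLICATION whose antecedents are Wang's `Cert 3 3 3 [] 20`, a
certified orbit table (Wang's printed values and the cell's 8 LP/LPDFS lifts), a passing singleton check and the
`NoExt` statement that the (not yet landed) data files assemble to. NOTHING here proves a bound on `R_𝔽₂(⟨3,3,3⟩)`;
no summit claim.

This file: the finite-set semantics of masks, counters and states used by the soundness proofs.
-/

set_option autoImplicit false

namespace Summit.Ventures.MM22.ProfileCert

section Basics

open Finset

/-- The forms of the root instance. -/
def forms : Finset ℕ := (Finset.range (NF + 1)).filter (fun f => f ≠ 0)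

/-- Membership in `forms`: the nonzero 9-bit patterns. -/
theorem mem_forms {f : ℕ} : f ∈ forms ↔ 1 ≤ f ∧ f ≤ NF := by
  simp only [forms, Finset.mem_filter, Finset.mem_range]; omega

/-- `isForm` decides membership in `forms`. -/
theorem isForm_iff {f : ℕ} : isForm f = true ↔ f ∈ forms := by
  simp [isForm, mem_forms]

/-! ## bit masks -/

/-- Bits of `allMask` are exactly the forms. -/
theorem testBit_allMask (f : ℕ) : allMask.testBit f = true ↔ f ∈ forms := by
  rw [mem_forms, allMask]
  cases f with
  | zero => simp [Nat.testBit_zero]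
  | succ i =>
    rw [Nat.testBit_succ]
    have : 2 * (2 ^ NF - 1) / 2 = 2 ^ NF - 1 := by omega
    rw [this, Nat.testBit_two_pow_sub_one]
    simp

/-- Our `maskOf` is (definitionally the same recursion as) the Literature `GoldbachLinnik.AConstCert.maskOf`; we reuse its bit lemma. -/
theorem maskOf_eq_lit (l : List ℕ) : maskOf l = Literature.NumberTheory.Sieve.GoldbachLinnik.AConstCert.maskOf l := by
  induction l with
  | nil => rfl
  | cons a l ih =>
    rw [maskOf, ih]
    rfl

/-- Membership in `l` is the bit test of `maskOf l` (the Literature lemma `AConstCert.testBit_maskOf`, transported). -/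
theorem mem_iff_testBit_maskOf (l : List ℕ) (f : ℕ) : f ∈ l ↔ (maskOf l).testBit f = true := by
  rw [maskOf_eq_lit]
  exact (Literature.NumberTheory.Sieve.GoldbachLinnik.AConstCert.testBit_maskOf l f).symm

/-- `countUpTo p n` counts the `i ∈ [1, n]` with `p i`. -/
theorem countUpTo_eq (p : ℕ → Bool) (n : ℕ) :
    countUpTo p n = (((Finset.range (n + 1)).filter (fun i => i ≠ 0)).filter (fun i => p i = true)).card := by
  induction n with
  | zero => rfl
  | succ n ih =>
    rw [countUpTo, ih, show Finset.range (n + 1 + 1) = insert (n + 1) (Finset.range (n + 1)) from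
      Finset.range_add_one, Finset.filter_insert, if_pos (Nat.succ_ne_zero n), Finset.filter_insert]
    by_cases h : p (n + 1) = true
    · rw [if_pos h, if_pos h, Finset.card_insert_of_notMem (by simp)]
    · rw [if_neg h, if_neg h, Nat.add_zero]

/-- `sumUpTo g n = ∑_{i ∈ [1,n]} g i`. -/
theorem sumUpTo_eq (g : ℕ → ℕ) (n : ℕ) :
    sumUpTo g n = ∑ i ∈ (Finset.range (n + 1)).filter (fun i => i ≠ 0), g i := by
  induction n with
  | zero => rfl
  | succ n ih =>
    rw [sumUpTo, ih, show Finset.range (n + 1 + 1) = insert (n + 1) (Finset.range (n + 1)) from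
      Finset.range_add_one, Finset.filter_insert, if_pos (Nat.succ_ne_zero n), Finset.sum_insert (by simp),
      Nat.add_comm]

/-- Counting over the forms. -/
theorem countUpTo_NF (p : ℕ → Bool) : countUpTo p NF = (forms.filter (fun i => p i = true)).card :=
  countUpTo_eq p NF

/-- `sumUpTo g NF` is the sum over the forms. -/
theorem sumUpTo_NF (g : ℕ → ℕ) : sumUpTo g NF = ∑ i ∈ forms, g i :=
  sumUpTo_eq g NF

/-! ## states -/

/-- IN set. -/
def St.inSet (s : St) : Finset ℕ := s.inL.toFinset
/-- OUT set (within the forms). -/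
def St.outSet (s : St) : Finset ℕ := forms.filter (fun f => s.out.testBit f = true)
/-- FREE set. -/
def St.freeSet (s : St) : Finset ℕ := forms.filter (fun f => s.free f = true)

/-- Well-formed states. -/
structure St.WF (s : St) : Prop where
  nodup : s.inL.Nodup
  in_form : ∀ f ∈ s.inL, f ∈ forms
  in_out : ∀ f ∈ s.inL, s.out.testBit f = false
  out_form : ∀ f, s.out.testBit f = true → f ∈ forms
  nIn_eq : s.nIn = s.inL.length
  nOut_eq : s.nOut = s.outSet.card

/-- `M` extends the state: contains IN, avoids OUT. -/
def St.Ext (s : St) (M : Finset ℕ) : Prop := (∀ f ∈ s.inL, f ∈ M) ∧ (∀ f ∈ M, s.out.testBit f = false)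

/-- What `free` tests. -/
theorem St.free_spec {s : St} {f : ℕ} :
    s.free f = true ↔ f ∈ forms ∧ f ∉ s.inL ∧ s.out.testBit f = false := by
  rw [← isForm_iff]
  unfold St.free
  rw [Bool.and_eq_true, Bool.and_eq_true, Bool.not_eq_true', Bool.not_eq_true', List.elem_eq_mem,
    decide_eq_false_iff_not, and_assoc]

/-- Membership in the FREE set. -/
theorem St.mem_freeSet {s : St} {f : ℕ} : f ∈ s.freeSet ↔ f ∈ forms ∧ f ∉ s.inL ∧ s.out.testBit f = false := by
  unfold St.freeSet
  rw [Finset.mem_filter, St.free_spec]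
  exact ⟨fun h => h.2, fun h => ⟨h.1, h⟩⟩

/-- `free` decides membership in the FREE set. -/
theorem St.free_iff {s : St} {f : ℕ} : s.free f = true ↔ f ∈ s.freeSet := by
  rw [St.mem_freeSet, St.free_spec]

/-- Bits of the FREE mask are exactly the FREE set (well-formed states). -/
theorem St.testBit_freeMask {s : St} (hW : s.WF) (f : ℕ) : s.freeMask.testBit f = true ↔ f ∈ s.freeSet := by
  rw [St.mem_freeSet]
  unfold St.freeMask
  rw [Nat.testBit_xor, Nat.testBit_or]
  have h1 := testBit_allMask f
  have h2 := (mem_iff_testBit_maskOf s.inL f).symm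
  have h3 := hW.in_form f
  have h4 := hW.out_form f
  constructor
  · intro h
    cases ha : allMask.testBit f <;> cases hb : (maskOf s.inL).testBit f <;>
      cases hc : s.out.testBit f <;> simp_all
  · rintro ⟨hf, hi, ho⟩
    have ha : allMask.testBit f = true := h1.2 hf
    have hb : (maskOf s.inL).testBit f = false := by
      cases h : (maskOf s.inL).testBit f
      · rfl
      · exact absurd (h2.1 h) hi
    simp [ha, hb, ho]

/-- There are `NF = 511` forms. -/
theorem card_forms : forms.card = NF := by
  unfold forms
  rw [Finset.filter_ne', Finset.card_erase_of_mem (by simp), Finset.card_range]; rfl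

/-- The three parts partition the forms: card identity. -/
theorem St.card_parts {s : St} (h : s.WF) : s.inSet.card + s.outSet.card + s.freeSet.card = NF := by
  have hforms : forms.card = NF := card_forms
  have hin : s.inSet ⊆ forms := fun f hf => h.in_form f (List.mem_toFinset.1 hf)
  -- forms = inSet ∪ outSet ∪ freeSet, pairwise disjoint
  have hunion : forms = s.inSet ∪ s.outSet ∪ s.freeSet := by
    ext f
    simp only [Finset.mem_union, St.inSet, List.mem_toFinset, St.outSet, Finset.mem_filter, St.mem_freeSet]
    constructor
    · intro hf
      by_cases hi : f ∈ s.inL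
      · exact Or.inl (Or.inl hi)
      · cases ho : s.out.testBit f
        · exact Or.inr ⟨hf, hi, rfl⟩
        · exact Or.inl (Or.inr ⟨hf, rfl⟩)
    · rintro ((hi | ⟨hf, _⟩) | ⟨hf, _, _⟩)
      · exact hin (List.mem_toFinset.2 hi)
      · exact hf
      · exact hf
  have hd1 : Disjoint s.inSet s.outSet := by
    rw [Finset.disjoint_left]; intro f hf ho
    simp only [St.outSet, Finset.mem_filter] at ho
    have := h.in_out f (List.mem_toFinset.1 hf); simp [this] at ho
  have hd2 : Disjoint (s.inSet ∪ s.outSet) s.freeSet := by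
    rw [Finset.disjoint_left]; intro f hf hfr
    rw [St.mem_freeSet] at hfr
    simp only [Finset.mem_union, St.inSet, List.mem_toFinset, St.outSet, Finset.mem_filter] at hf
    rcases hf with hf | ⟨_, ho⟩
    · exact hfr.2.1 hf
    · simp [hfr.2.2] at ho
  rw [← hforms, hunion, Finset.card_union_of_disjoint hd2, Finset.card_union_of_disjoint hd1]

/-- The IN set has `nIn` elements. -/
theorem St.inSet_card {s : St} (h : s.WF) : s.inSet.card = s.nIn := by
  rw [h.nIn_eq, St.inSet, List.toFinset_card_of_nodup h.nodup]

/-- `nFree` counts the FREE set. -/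
theorem St.nFree_eq {s : St} (h : s.WF) : s.nFree = s.freeSet.card := by
  have := St.card_parts h
  rw [St.nFree, ← St.inSet_card h, h.nOut_eq]; omega

/-- `inU` is the size of `IN ∩ U`. -/
theorem St.inU_eq {s : St} (h : s.WF) (r : Row) :
    s.inU r = (s.inSet.filter (fun f => r.mask.testBit f = true)).card := by
  rw [St.inU, List.countP_eq_length_filter, St.inSet, ← List.toFinset_filter,
    List.toFinset_card_of_nodup (h.nodup.filter _)]

/-- `freeU` is the size of `FREE ∩ U`. -/
theorem St.freeU_eq {s : St} (h : s.WF) (r : Row) :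
    s.freeU r = (s.freeSet.filter (fun f => r.mask.testBit f = true)).card := by
  have hset : forms.filter (fun f => (s.freeMask &&& r.mask).testBit f = true)
      = s.freeSet.filter (fun f => r.mask.testBit f = true) := by
    ext f
    rw [Finset.mem_filter, Finset.mem_filter, Nat.testBit_and, Bool.and_eq_true, St.testBit_freeMask h]
    constructor
    · rintro ⟨_, hm, hr⟩; exact ⟨hm, hr⟩
    · rintro ⟨hm, hr⟩; exact ⟨(St.mem_freeSet.1 hm).1, hm, hr⟩
  rw [← hset, ← countUpTo_NF]
  rfl


end Basics

end Summit.Ventures.MM22.ProfileCert
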